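import Summits.QuantumFields.YangMills.Theorems.BalabanUVNodesSpineRates
import Summits.QuantumFields.YangMills.Theorems.BalabanUVNodesN15Knit
import Literature.MathematicalPhysics.QuantumFieldTheory.Balaban1983to89.T4FiniteEpsInhabited

/-!
# YM-DAG node N15 (= NE2) AT THE RATE CARRIERS OF RECORD: the K4 stub `YMDAG.UVSplit.S_N15 RRec` of route module 2 (`BalabanUVNodesSpineRates`
# p418381) — (W2) readings, REFINEMENT-GENERIC closers over every rate-carrier predicate `RRec` carrying a producer slot of dag-n15-a's knit
# (`N15Knit.N15unit_of_covarianceTowerRate` ∕ `N15unit_of_kingLeaves` BY NAME), and the (W2) GUARDS: a NON-DEGENERATE inhabitant on which `S_N15`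
# FIRES hypothesis-free (PART 1's Landau-gauge LG family on the four-dimensional unit tori, `N15Knit.N15_with_zero_layers_dim4`), the rate-less
# refutation (`N15Knit.not_N15op_rateless`), vacuity over an empty predicate, and the empty-index A2 trap located

Track A of `YM-PLAN.md` (cell `pub-ymgap`, HUMAN RULING D-0062), node **N15**; typed by seat `pub-ymgap-dag-n27-a` (generation 4) under dag-lead's
REBALANCE №42 (file name as assigned; the carriers are cluster K4's RATE carriers `R.ne2 : NE2Carriers` of `RateCarriers N`, not the K5 spine carriers).
Owner of record for N15's content: seat `pub-ymgap-dag-n15-a` (knit parts `N15Knit`, `N15DefectKernel*`, …) — consumed BY NAME only, nothing restated.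
Shape twins: `BalabanUVNodesN20AtSpineCarriers` (this seat, p421432), dag-n22-a's `BalabanUVNodesN22AtRecord`, dag-n18-a's `BalabanUVNodesN18AtRecord`.
Kernel bookkeeping: 0 `def`, 0 `sorry`, standard axioms.  COUNT-NEUTRAL; `--supports` the K4∕K5 item `SpineGivenEndpoint` (stmt-QuantumFields-19182).

THE STUB.  `S_N15 RRec := ∀ F D g₀ os R, RRec F D g₀ os R → N15At R.ne2`, `N15At c := NE2PlusOperator c.c35 c.pi c.Kop ∧ NE2PlusSite 4 c.p c.c35 c.pi
c.Ksite ∧ NE2PlusUnit c.c35 c.pi c.Kunit c.inΛ c.unitDist` — the three NE2⁺ layers (η-rate of the background-dependent linear theory: operator ∕ site-kernel ∕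
unit-lattice) on ONE family of paired instances.  IN PRINT only the scalar `A = 0` template [King1986] Lemma 4.5 (4.38); the background layers are NOT PRINTED
and NOT PROVED ([Balaban1985BackgroundPropagators] Thms 3.1 ∕ 3.2 ∕ 3.15 print uniformity in the spacing, never an η-difference).

WHAT THIS MODULE IS.
* §1 (W2) READINGS: `s_N15_iff` (`Iff.rfl`), `n15At_iff`, `s_N15_antitone` (in `RRec`), `s_N15_of_refines`, `ratesAt_n15` (K4's per-string conclusion
  `RatesAt D R` carries it), and the node's consumer faces at the record (`ne2PlusOperator_at_record`, `ne2PlusSite_at_record`, `ne2PlusUnit_at_record`).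
* §2 (W2) CLOSERS, refinement-generic over every `RRec` carrying the slot: `s_N15_of_layersReading` (the three layers handed separately);
  **`s_N15_of_covarianceTowerRateReading`** (operator + site layers handed as displayed hypotheses — no background producer exists in the tree —, the
  UNIT layer from King's (4.38)-shape `NE2KingTransplant.CovarianceTowerRate` package at every (3.35)∧(3.36)-regular background, `N15Knit.N15unit_of_covarianceTowerRate`
  BY NAME); **`s_N15_of_kingLeavesReading`** (the same with King's four leaves (H1) `UniformCoercive` ∧ (H2) `UniformCTBound` ∧ (H2′) `UniformKernelDecay` ∧
  (H3) `EffectiveOperatorSupRate` ∧ (H4) `VolumeSum`, `N15Knit.N15unit_of_kingLeaves` BY NAME).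
* §3 (W2) GUARDS: **`s_N15_fires_on_knitCarriers`** (INHABITED + FIRES, NON-DEGENERATE: an `RRec` over SU(2) data pinning ONE rate bundle whose NE2 component is
  PART 1's Landau-gauge LG family at `U ≡ 1` on the four-dimensional unit tori (`knitInstance 3 2`, `knitOp166`, `knitSite163`, `covOpKernels`, `inAll`,
  `rhoDist`), inhabited at some `(F, D, g₀, os)`, on which `S_N15` FIRES HYPOTHESIS-FREE by `N15Knit.N15_with_zero_layers_dim4`; the bundle's other three
  components are «don't-care» fillers of no content, DISPLAYED); `not_s_N15_of_admits` (R422 at node level); **`not_s_N15_of_admits_rateless`** (an `RRec`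
  admitting a bundle whose NE2 operator family is the RATE-LESS `X_N k ≡ 2^k` on the knit carriers at `L = 2` has NO `S_N15`, whatever `c35` and the other
  layers — `N15Knit.not_N15op_rateless`); `s_N15_of_empty` (vacuity over an empty predicate); A2 TRAP LOCATED `n15At_of_isEmpty` ∕ `s_N15_of_emptyIndexReading`
  (a bundle with NO paired instances carries `N15At` vacuously ⇒ the `RRec` author must pin `R.ne2.I` = Bałaban's run-indexed instances, inhabited).

HONEST FRAMING.  NE2 is NOT PRINTED beyond King's scalar template and NOT PROVED for the background layers.  `S_N15 RRec` quantifies over the rate carriers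
OF RECORD that `RRec` pins (NODE 00 ∕ NODE O — no such predicate exists in the tree); this file says what a record predicate must supply for N15 to follow
from the tree's constructors and shows the slot is neither void nor free.  Every leaf, tower rate and regularity window is a HYPOTHESIS; nothing of Bałaban's
is asserted or instantiated; N15 is NOT discharged (0∕1 at every record); typed 28∕28, discharged count untouched; one finite four-torus programme at fixed
`ε` — NOT ℝ⁴, NOT infinite volume, NOT OS, NOT a mass gap, NOT Clay.  Restate-immune.  No decl below carries a cite tag.
-/

noncomputable section

open Finset

namespace Summit.QuantumFields.YangMills.Theorems.N15AtSpineCarriers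

open Literature.MathematicalPhysics.QuantumFieldTheory.Balaban1983to89
open Literature.MathematicalPhysics.QuantumFieldTheory.Balaban1983to89.T4Continuum
open Literature.MathematicalPhysics.QuantumFieldTheory.Balaban1983to89.T4EtaRate (PairedInstance NE2PlusOperator NE2PlusSite NE2PlusUnit)
open Literature.MathematicalPhysics.QuantumFieldTheory.Balaban1983to89.NE2NodeTorus (KnitIndex knitInstance knitOp knitOp166 knitSite163
  covOpKernels inAll rhoDist)
open Summit.QuantumFields.BalabanUV.T4Continuum.NE2KingTransplant (IsPseudoMetric UniformCoercive UniformCTBound UniformKernelDecay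
  EffectiveOperatorSupRate VolumeSum CovarianceTowerRate)
open Summit.QuantumFields.YangMills.Theorems.BalabanUVNodesN15Knit (N15unit_of_covarianceTowerRate N15unit_of_kingLeaves not_N15op_rateless
  N15_with_zero_layers_dim4)
open YMDAG.UVSplit (Datum NE2Carriers RateCarriers RateRecordPred N15At RatesAt S_N15)

variable {N : ℕ} [NeZero N]

/-! ## §1 (W2) readings: the stub unfolded, the layers, variance, K4's conjunct, consumer faces -/

/-- **What `S_N15 RRec` says** (`Iff.rfl`): at every rate bundle the record predicate pins, N15 on its NE2 component. [bookkeeping] -/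
theorem s_N15_iff (RRec : RateRecordPred N) :
    S_N15 RRec ↔ ∀ (F : T4Family) (D : Datum F N) (g₀ : ℕ → ℝ) (os : List (ULoop F)) (R : RateCarriers N),
      RRec F D g₀ os R → N15At R.ne2 :=
  Iff.rfl

/-- **What `N15At c` says** (`Iff.rfl`): the three NE2⁺ layers on the carriers' family of paired instances. [bookkeeping] -/
theorem n15At_iff (c : NE2Carriers) :
    N15At c ↔ NE2PlusOperator c.c35 c.pi c.Kop ∧ NE2PlusSite 4 c.p c.c35 c.pi c.Ksite ∧ NE2PlusUnit c.c35 c.pi c.Kunit c.inΛ c.unitDist :=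
  Iff.rfl

/-- `S_N15` is ANTITONE in the rate-record predicate (a predicate carrying MORE inherits it). [bookkeeping] -/
theorem s_N15_antitone {RRec RRec' : RateRecordPred N}
    (hle : ∀ (F : T4Family) (D : Datum F N) (g₀ : ℕ → ℝ) (os : List (ULoop F)) (R : RateCarriers N), RRec' F D g₀ os R → RRec F D g₀ os R)
    (h : S_N15 RRec) : S_N15 RRec' :=
  fun F D g₀ os R hR => h F D g₀ os R (hle F D g₀ os R hR)

/-- The refinement-generic transfer in closer form. [bookkeeping] -/
theorem s_N15_of_refines (RRec₀ RRec : RateRecordPred N) (h₀ : S_N15 RRec₀)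
    (hle : ∀ (F : T4Family) (D : Datum F N) (g₀ : ℕ → ℝ) (os : List (ULoop F)) (R : RateCarriers N), RRec F D g₀ os R → RRec₀ F D g₀ os R) :
    S_N15 RRec :=
  s_N15_antitone hle h₀

/-- K4's per-string conclusion `RatesAt D R` carries N15 on the bundle's NE2 component. [bookkeeping] -/
theorem ratesAt_n15 {F : T4Family} {D : Datum F N} {R : RateCarriers N} (h : RatesAt D R) : N15At R.ne2 := h.2.1

section AtRecord

variable {RRec : RateRecordPred N} {F : T4Family} {D : Datum F N} {g₀ : ℕ → ℝ} {os : List (ULoop F)} {R : RateCarriers N}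

/-- The operator layer at a bundle of record. [bookkeeping] -/
theorem ne2PlusOperator_at_record (h : S_N15 RRec) (hR : RRec F D g₀ os R) : NE2PlusOperator R.ne2.c35 R.ne2.pi R.ne2.Kop :=
  (h F D g₀ os R hR).1

/-- The site-kernel layer at a bundle of record (`d = 4`). [bookkeeping] -/
theorem ne2PlusSite_at_record (h : S_N15 RRec) (hR : RRec F D g₀ os R) : NE2PlusSite 4 R.ne2.p R.ne2.c35 R.ne2.pi R.ne2.Ksite :=
  (h F D g₀ os R hR).2.1

/-- The unit-lattice layer at a bundle of record. [bookkeeping] -/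
theorem ne2PlusUnit_at_record (h : S_N15 RRec) (hR : RRec F D g₀ os R) :
    NE2PlusUnit R.ne2.c35 R.ne2.pi R.ne2.Kunit R.ne2.inΛ R.ne2.unitDist :=
  (h F D g₀ os R hR).2.2

end AtRecord

/-! ## §2 (W2) closers, refinement-generic over every rate-carrier predicate carrying a producer slot -/

/-- **`S_N15` FOR EVERY THREE-LAYERS READING**: a predicate handing, with every bundle it pins, the three NE2⁺ layers on the NE2 component (each as a
hypothesis of its own provenance) has `S_N15`. [bookkeeping] -/
theorem s_N15_of_layersReading (RRec : RateRecordPred N)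
    (hread : ∀ (F : T4Family) (D : Datum F N) (g₀ : ℕ → ℝ) (os : List (ULoop F)) (R : RateCarriers N), RRec F D g₀ os R →
      NE2PlusOperator R.ne2.c35 R.ne2.pi R.ne2.Kop ∧ NE2PlusSite 4 R.ne2.p R.ne2.c35 R.ne2.pi R.ne2.Ksite ∧
        NE2PlusUnit R.ne2.c35 R.ne2.pi R.ne2.Kunit R.ne2.inΛ R.ne2.unitDist) :
    S_N15 RRec :=
  fun F D g₀ os R hR => hread F D g₀ os R hR

/-- **`S_N15` FOR EVERY COVARIANCE-TOWER-RATE READING OF THE UNIT LAYER.**  If `RRec` hands, with every bundle `R` it pins: the operator and site layers on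
`R.ne2` (displayed hypotheses), and for the UNIT layer King's (4.38)-shape package — the unit kernel of every instance `i`, at every configuration `U` in the
(3.35)∧(3.36)-regular window with index-uniform `a₀`, IS the one-step η-difference of a tower of unit-lattice effective operators `D i U k + B i U` read at
embedded sites `e i`, carrying `NE2KingTransplant.CovarianceTowerRate (D i U) (B i U) (dm i) C κ′ s` with `0 < C`, `0 < κ′`, `0 < s < 1`, and
`R.ne2.unitDist ≤ dm ∘ e` — then `S_N15 RRec` (`N15Knit.N15unit_of_covarianceTowerRate` BY NAME). [bookkeeping] -/
theorem s_N15_of_covarianceTowerRateReading (RRec : RateRecordPred N)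
    (hread : ∀ (F : T4Family) (D : Datum F N) (g₀ : ℕ → ℝ) (os : List (ULoop F)) (R : RateCarriers N), RRec F D g₀ os R →
      NE2PlusOperator R.ne2.c35 R.ne2.pi R.ne2.Kop ∧ NE2PlusSite 4 R.ne2.p R.ne2.c35 R.ne2.pi R.ne2.Ksite ∧
      ∃ (n : R.ne2.I → Type) (_ : ∀ i, Fintype (n i)) (_ : ∀ i, DecidableEq (n i))
        (e : ∀ i, (R.ne2.pi i).gc.Site → n i) (dm : ∀ i, n i → n i → ℝ)
        (Dm : ∀ i, (R.ne2.pi i).Bf.Cfg → ℕ → Matrix (n i) (n i) ℝ) (Bm : ∀ i, (R.ne2.pi i).Bf.Cfg → Matrix (n i) (n i) ℝ)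
        (a₀ C κ' s : ℝ), 0 < a₀ ∧ 0 < C ∧ 0 < κ' ∧ 0 < s ∧ s < 1 ∧
        (∀ i y y', R.ne2.unitDist i y y' ≤ dm i (e i y) (e i y')) ∧
        (∀ (i : R.ne2.I) (α₀ : ℝ), 0 < α₀ → (R.ne2.pi i).gf.M * α₀ ≤ a₀ → ∀ U : (R.ne2.pi i).Bf.Cfg,
          (R.ne2.pi i).Bf.Reg335 R.ne2.c35 α₀ U → (R.ne2.pi i).Bf.Reg336 R.ne2.c35 α₀ U →
            CovarianceTowerRate (Dm i U) (Bm i U) (dm i) C κ' s ∧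
            ∀ y y', (R.ne2.Kunit i).ker U y y' =
              (Dm i U ((R.ne2.pi i).gc.k + 1) + Bm i U)⁻¹ (e i y) (e i y') - (Dm i U (R.ne2.pi i).gc.k + Bm i U)⁻¹ (e i y) (e i y'))) :
    S_N15 RRec := by
  intro F D g₀ os R hR
  obtain ⟨hop, hsite, n, _, _, e, dm, Dm, Bm, a₀, C, κ', s, ha, hC, hκ', hs0, hs1, hdist, hK⟩ := hread F D g₀ os R hR
  exact ⟨hop, hsite, N15unit_of_covarianceTowerRate ha e dm Dm Bm hC hκ' hs0 hs1 hdist hK⟩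

/-- **`S_N15` FOR EVERY KING-LEAVES READING OF THE UNIT LAYER.**  As `s_N15_of_covarianceTowerRateReading`, with the tower rate REPLACED by King's four
leaves uniformly over the regular backgrounds — (H1) `UniformCoercive (D i U) (B i U) γ`, (H2) `UniformCTBound (D i U) (B i U) (dm i) κ ρ ρB`, (H2′)
`UniformKernelDecay (D i U) (dm i) C₁ κ`, (H3) `EffectiveOperatorSupRate (D i U) ε r`, (H4) `VolumeSum (dm i) κ V` — with `ρ + ρB < γ`, `0 < κ, ε, C₁, V`,
`0 < r < 1`, pseudo-metrics `dm i`; then `S_N15 RRec` (`N15Knit.N15unit_of_kingLeaves` BY NAME: the scalar template [King1986] Lemma 4.5 transplanted).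
(H3) is the two-spacing leaf one layer below; at a background it is the row's open estimate. [bookkeeping] -/
theorem s_N15_of_kingLeavesReading (RRec : RateRecordPred N)
    (hread : ∀ (F : T4Family) (D : Datum F N) (g₀ : ℕ → ℝ) (os : List (ULoop F)) (R : RateCarriers N), RRec F D g₀ os R →
      NE2PlusOperator R.ne2.c35 R.ne2.pi R.ne2.Kop ∧ NE2PlusSite 4 R.ne2.p R.ne2.c35 R.ne2.pi R.ne2.Ksite ∧
      ∃ (n : R.ne2.I → Type) (_ : ∀ i, Fintype (n i)) (_ : ∀ i, DecidableEq (n i))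
        (e : ∀ i, (R.ne2.pi i).gc.Site → n i) (dm : ∀ i, n i → n i → ℝ)
        (Dm : ∀ i, (R.ne2.pi i).Bf.Cfg → ℕ → Matrix (n i) (n i) ℝ) (Bm : ∀ i, (R.ne2.pi i).Bf.Cfg → Matrix (n i) (n i) ℝ)
        (a₀ γ κ ρ ρB ε C₁ V r : ℝ), 0 < a₀ ∧ ρ + ρB < γ ∧ 0 < κ ∧ 0 < ε ∧ 0 < C₁ ∧ 0 < V ∧ 0 < r ∧ r < 1 ∧
        (∀ i, IsPseudoMetric (dm i)) ∧
        (∀ i y y', R.ne2.unitDist i y y' ≤ dm i (e i y) (e i y')) ∧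
        (∀ (i : R.ne2.I) (α₀ : ℝ), 0 < α₀ → (R.ne2.pi i).gf.M * α₀ ≤ a₀ → ∀ U : (R.ne2.pi i).Bf.Cfg,
          (R.ne2.pi i).Bf.Reg335 R.ne2.c35 α₀ U → (R.ne2.pi i).Bf.Reg336 R.ne2.c35 α₀ U →
            UniformCoercive (Dm i U) (Bm i U) γ ∧ UniformCTBound (Dm i U) (Bm i U) (dm i) κ ρ ρB ∧
            UniformKernelDecay (Dm i U) (dm i) C₁ κ ∧ EffectiveOperatorSupRate (Dm i U) ε r ∧ VolumeSum (dm i) κ V ∧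
            ∀ y y', (R.ne2.Kunit i).ker U y y' =
              (Dm i U ((R.ne2.pi i).gc.k + 1) + Bm i U)⁻¹ (e i y) (e i y') - (Dm i U (R.ne2.pi i).gc.k + Bm i U)⁻¹ (e i y) (e i y'))) :
    S_N15 RRec := by
  intro F D g₀ os R hR
  obtain ⟨hop, hsite, n, _, _, e, dm, Dm, Bm, a₀, γ, κ, ρ, ρB, ε, C₁, V, r, ha, hγ, hκ, hε, hC₁, hV, hr0, hr1, hd, hdist, hK⟩ :=
    hread F D g₀ os R hR
  exact ⟨hop, hsite, N15unit_of_kingLeaves ha e dm Dm Bm hγ hκ hε hC₁ hV hr0 hr1 hd hdist hK⟩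

/-! ## §3 (W2) guards: a non-degenerate inhabitant FIRING hypothesis-free; the slot decides; empty-predicate vacuity; the empty-index trap -/

/-- **INHABITED AND FIRING, NON-DEGENERATE.**  For every choice of the kernel labels and constants there are a rate bundle `R₀ : RateCarriers 2` and a
rate-record predicate `RRec` over `SU(2)` data such that: `RRec` pins exactly `R₀`; it is INHABITED at some family, datum, bare sequence and string
(`T4FiniteEpsInhabited.nonempty_finiteEpsData_SU`); `R₀`'s NE2 component is PART 1's Landau-gauge LG family at `U ≡ 1` on the FOUR-DIMENSIONAL unit tori
(paired instances `knitInstance 3 2`, operator kernels `knitOp166 2 0 1 a b` = Δ_k (1.66), site kernels `knitSite163 2 μ′ λ` = H_k (1.63), unit kernels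
`covOpKernels 2 α β` = C^{(k)} (2.156), `inAll`, `rhoDist`) — DISPLAYED in the statement; and `S_N15 RRec` HOLDS, hypothesis-free, by dag-n15-a's
`N15Knit.N15_with_zero_layers_dim4`.  The bundle's NE1′ ∕ NE3 ∕ U3 components are «don't-care» fillers (empty run-parameter type, numeric zeros, the
one-domain reader) of NO content — the rider certifies the N15 slot only. [bookkeeping] -/
theorem s_N15_fires_on_knitCarriers (a b μ' lam α β : Fin 4) (c35 p : ℝ) :
    ∃ (R₀ : RateCarriers 2) (RRec : RateRecordPred 2),
      (∀ (F : T4Family) (D : Datum F 2) (g₀ : ℕ → ℝ) (os : List (ULoop F)) (R : RateCarriers 2), RRec F D g₀ os R ↔ R = R₀) ∧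
      (∃ (F : T4Family) (D : Datum F 2) (g₀ : ℕ → ℝ) (os : List (ULoop F)), RRec F D g₀ os R₀) ∧
      R₀.ne2 = { I := KnitIndex 3 2, c35 := c35, p := p, pi := knitInstance 3 2, Kop := knitOp166 2 0 1 a b,
                 Ksite := knitSite163 2 μ' lam, Kunit := covOpKernels 2 α β, inΛ := inAll 2, unitDist := rhoDist 2 } ∧
      S_N15 RRec := by
  let c₀ : NE2Carriers :=
    { I := KnitIndex 3 2, c35 := c35, p := p, pi := knitInstance 3 2, Kop := knitOp166 2 0 1 a b,
      Ksite := knitSite163 2 μ' lam, Kunit := covOpKernels 2 α β, inΛ := inAll 2, unitDist := rhoDist 2 }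
  let R₀ : RateCarriers 2 :=
    { ne1 := ⟨Empty, ⟨fun q => q.elim, fun q => q.elim, fun q => q.elim⟩, 0⟩
      ne2 := c₀
      ne3 := ⟨1, 1, 1, 0, 0, 0, 0, 0, ∅⟩
      u3 := { C := ⟨Unit, fun _ => 1, fun _ => 0, fun _ => le_rfl, Unit, Unit, fun _ _ => 0, fun _ _ => le_rfl, id⟩,
              W := Set.univ, γ := 1, κ := 0, EA := fun g _ _ => g 0, EB := fun _ g _ _ => g 0, θ := 0, C₅ := 0,
              Λ := fun _ _ => 0, C₉ := 0, ω := 0, cr := 0, ρ := 0 } }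
  obtain ⟨D⟩ := T4FiniteEpsInhabited.nonempty_finiteEpsData_SU (⟨13, ⟨⟨6, rfl⟩, by norm_num⟩, by norm_num, 1, le_rfl⟩ : T4Family) 2
  refine ⟨R₀, fun _ _ _ _ R => R = R₀, fun _ _ _ _ _ => Iff.rfl, ⟨_, D, fun _ => 1, [], rfl⟩, rfl, ?_⟩
  intro F D' g₀ os R hR
  subst hR
  exact (N15_with_zero_layers_dim4 2 le_rfl (show (0 : Fin 4) ≠ 1 by decide) a b μ' lam α β c35 p).1

/-- **R422 AT NODE LEVEL**: a rate-record predicate admitting one bundle WITHOUT `N15At` has no `S_N15`. [bookkeeping] -/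
theorem not_s_N15_of_admits (RRec : RateRecordPred N)
    (h : ∃ (F : T4Family) (D : Datum F N) (g₀ : ℕ → ℝ) (os : List (ULoop F)) (R : RateCarriers N), RRec F D g₀ os R ∧ ¬ N15At R.ne2) :
    ¬ S_N15 RRec := by
  rintro hS
  obtain ⟨F, D, g₀, os, R, hR, hn⟩ := h
  exact hn (hS F D g₀ os R hR)

/-- **THE SLOT DECIDES — THE RATE-LESS FAMILY REFUTES `S_N15`.**  A rate-record predicate admitting a bundle whose NE2 component has the knit carriers
`knitInstance 3 2` with the RATE-LESS operator family `X_N k ≡ 2^k` (no η-rate at all) has NO `S_N15` — whatever its `c35`, exponent, site ∕ unit kernels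
and other components (`N15Knit.not_N15op_rateless` BY NAME: the operator layer would force `2^k ≤ B₀` for all `k`).  N15's content is a genuine RATE.
[bookkeeping] -/
theorem not_s_N15_of_admits_rateless (RRec : RateRecordPred N) (c35 p : ℝ) (μ' lam α β : Fin 4)
    (h : ∃ (F : T4Family) (D : Datum F N) (g₀ : ℕ → ℝ) (os : List (ULoop F)) (R : RateCarriers N), RRec F D g₀ os R ∧
      R.ne2 = { I := KnitIndex 3 2, c35 := c35, p := p, pi := knitInstance 3 2,
                Kop := knitOp 2 (fun _ _ k _ => (2 : ℝ) ^ k), Ksite := knitSite163 2 μ' lam, Kunit := covOpKernels 2 α β,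
                inΛ := inAll 2, unitDist := rhoDist 2 }) :
    ¬ S_N15 RRec := by
  rintro hS
  obtain ⟨F, D, g₀, os, R, hR, hne2⟩ := h
  have h15 := hS F D g₀ os R hR
  rw [hne2] at h15
  obtain ⟨hop, -, -⟩ := h15
  exact not_N15op_rateless 3 c35 hop

/-- **VACUITY over an empty predicate**: an `RRec` pinning no bundle has `S_N15` for free — which is why the INHABITED rider and K4's existence stub
`S_R00x` matter. [bookkeeping] -/
theorem s_N15_of_empty (RRec : RateRecordPred N)
    (h : ∀ (F : T4Family) (D : Datum F N) (g₀ : ℕ → ℝ) (os : List (ULoop F)) (R : RateCarriers N), ¬ RRec F D g₀ os R) :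
    S_N15 RRec :=
  fun F D g₀ os R hR => absurd hR (h F D g₀ os R)

/-- **A2 TRAP, LOCATED — NO PAIRED INSTANCES, NO CONTENT.**  NE2 carriers with an EMPTY index of paired instances carry `N15At` vacuously (every layer is
`∃ positive constants, ∀ i, …`; take all constants `1`, `θ = 1∕2`). [bookkeeping] -/
theorem n15At_of_isEmpty (c : NE2Carriers) [IsEmpty c.I] : N15At c :=
  ⟨⟨1, 1, 1, 1, 1, one_pos, one_pos, one_pos, one_pos, one_pos, fun i => isEmptyElim i⟩,
    ⟨1, 1, 1, 1, 1, one_pos, one_pos, one_pos, one_pos, one_pos, fun i => isEmptyElim i⟩,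
    ⟨1, 1, 1, 1 / 2, one_pos, one_pos, one_pos, by norm_num, by norm_num, fun i => isEmptyElim i⟩⟩

/-- … hence a rate-record predicate pinning bundles WITHOUT paired instances has `S_N15` with no estimate at all — reading for the `RRec` author (NODE 00 ∕
NODE O): pin `R.ne2.I` to Bałaban's run-indexed paired instances (inhabited: one instance per pair of scales of the run), never a free index type.
[bookkeeping] -/
theorem s_N15_of_emptyIndexReading (RRec : RateRecordPred N)
    (hread : ∀ (F : T4Family) (D : Datum F N) (g₀ : ℕ → ℝ) (os : List (ULoop F)) (R : RateCarriers N), RRec F D g₀ os R → IsEmpty R.ne2.I) :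
    S_N15 RRec := by
  intro F D g₀ os R hR
  haveI := hread F D g₀ os R hR
  exact n15At_of_isEmpty R.ne2

end Summit.QuantumFields.YangMills.Theorems.N15AtSpineCarriers

end
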